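import Mathlib
import HarnessLib
import HarnessLib.Audit
import Summits.CriticalPhenomena.Statement
import Literature.Probability.LatticeModels.GibbsSpecification
import Summits.CriticalPhenomena.Ising3DConformalLimit.Theorems.AnomalousForcesInteractionDeltaLowerBound
import HarnessLib.Audit.Status.Attr

/-!
Route: OctaveForgetting

# Route OctaveForgetting — lattice spheres forget faster than the free field — maximal-correlation
contraction along the exact shell Markov chain gives eta(3) > 0

It suffices to show X = X_F ∧ X_AFI. X_F = SphereForgetting, the bet of card
octave-forgets-more-than-half in its L² form
(the card's (C′); its entropy form (C) is strictly stronger since η_KL ≥ ρ_max², Ahlswede–Gács): for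
some ratio L ≥ 2 and some
θ with θ·L < 1, for all large r, every function f of the spins on the lattice sphere S_r = {x ∈ ℤ³ :
r² ≤ |x|² < (r+1)²} and every
function g of the spins on S_{Lr} satisfy Cov(f,g)² ≤ θ·Var f·Var g under the critical state
μ_{β_c(3)} (maximal correlation of the
two sphere σ-algebras ≤ √θ; for the massless free field the top canonical correlation² over ratio L
is EXACTLY 1/L by Newton's shell
theorem — "each octave forgets half" — so θ·L < 1 says the critical crystal forgets strictly
faster). Three provable-now sphere
lemmas convert X_F into the Target, η(3) > 0 in power form (= item EtaPositive of route
AnomalousForcesInteraction, shared): maximal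
correlations MULTIPLY along the exact DLR Markov chain σ₀ → S_{r₀} → S_{Lr₀} → S_{L²r₀} → …
(ForgettingComposes), while
Corr(σ₀, Σ_{y∈S_R} σ_y)² ≥ c·R·G(3R e₁)² by GKS + Messager–Miracle-Solé + the x-space infrared bound
(SphereCovarianceLowerBound,
SphereVarianceUpperBound); hence c R G(3Re₁)² ≤ θ^k at R = L^k r₀ and G(x) ≤ C‖x‖^{-(1+κ)/2} with κ
= log(1/θ)/log L > 1
(EtaFromForgetting). X_AFI = GaussianLimitIsFree ∧ DeltaLowerBound ∧ MoebiusLimit, the items of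
route AnomalousForcesInteraction
re-filed verbatim (shared): with η > 0 they force U₄ ≢ 0 and deliver the conjunct.
Lean: `SphereForgetting ∧
Summit.CriticalPhenomena.Ising3DConformalLimit.Theses.AnomalousForcesInteraction.GaussianLimitIsFree
∧ Summit.CriticalPhenomena.Ising3DConformalLimit.Theses.AnomalousForcesInteraction.DeltaLowerBound ∧
Summit.CriticalPhenomena.Ising3DConformalLimit.Theses.AnomalousForcesInteraction.MoebiusLimit`

## Assembly
Pure logic plus one linarith, verified sorry-free in the planner's Sketch.lean (theorem
assembly_holds, axioms propext /
Classical.choice / Quot.sound): EtaFromForgetting applied to the four sphere statements gives κ > 0,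
C with the Target bound; take
(ρ, Δ, S) from MoebiusLimit; if HasNontrivialU4 S failed, GaussianLimitIsFree (translation
invariance and scale covariance read off
IsMoebiusCovariant as hM.1.1, hM.2.1) gives Δ = 1/2 while DeltaLowerBound with a := 1+κ gives 1+κ ≤
2Δ = 1, contradiction; so
⟨ρ, Δ, S, …, U₄ ≢ 0⟩ is the conjunct (root abbrev Ising3DConformalLimit).

Rationale: WHY THIS LINE. Import from INFORMATION THEORY with an explicit dictionary: nested separating lattice
shells are an exact time-inhomogeneous Markov
chain of the n.n. Gibbs state (DLR), one RG step is one use of the channel S_r → S_{Lr}, and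
contraction coefficients COMPOSE along
Markov chains — maximal correlation submultiplicatively (doi:10.1137/0128010 Witsenhausen 1975;
doi:10.1214/aop/1176995937
Ahlswede–Gács 1976; PolyanskiyWu2017; the tree template is EvansEtAl2000, where an SDPI-type upper
bound against a linear-estimator
lower bound decides reconstruction). The free field calibrates the scale exactly: for Gaussian
fields ρ_max is the top canonical
correlation (doi:10.1137/1105018 Kolmogorov–Rozanov), which between S_r and S_R is the ℓ = 0 mode
with corr² = r/R, so the infrared
bound reads "forget at least 1/L per L-ade" and an anomalous dimension is an EXCESS forgetting rate;
radial quantisation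
(doi:10.1007/BF01608988 Lüscher–Mack; fuzzy-sphere spectra arXiv:2210.13482) predicts θ*(L) →
L^{-2Δσ} = L^{-1.036}. What it does
that prior routes do not: AnomalousForcesInteraction and PerfectScreening CONSUME η > 0 (resp.
non-saturation) and no route or card
offers an engine for a two-point UPPER bound beyond the infrared bound; this line relocates all of η
> 0 into ONE dimensionless
per-scale inequality on a spectral object (the second singular value of the annulus
conditional-expectation operator), sharp on the
GFF, with the conversion to a pointwise exponent resting only on PROVED tree facts
(criticalTwoPoint_bounds_holds,
hasUniqueGibbsMeasure_criticalBeta_holds, exists_plusMeasure_holds,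
twoPointFree_le_of_mul_supNorm_le, GibbsStrongMarkov).

RANKED CRUXES. #0 Target (target) — η(3) > 0 in upper-bound power form: there are κ > 0 and C with
⟨σ₀σ_x⟩⁺_{β_c(3)} ≤ C‖x‖^{-(1+κ)} for all x ≠ 0 (sup norm) — verbatim EtaPositive (item
stmt-CriticalPhenomena-2600) of route AnomalousForcesInteraction, the dividend this route exists to
produce; X_F plus the three sphere lemmas give it (EtaFromForgetting), and with X_AFI it yields the
conjunct. (why it might fail: inherits SphereForgetting; η(3) ≈ 0.036 is tiny and every rigorous
tool is consistent with saturation G ≍ ‖x‖⁻¹; a proof of G ≥ c‖x‖⁻¹ along a sequence refutes it.)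
[DuminilcopinPanis2025, DuminilCopinICM2022, AizenmanDuminilCopinAnnals2021, PolandRychkovVichi2019]
#2 SphereForgetting (crux) — (card (C′), free ratio) there are L ≥ 2, θ ∈ [0, 1/L) and r₀ ≥ 1 such
that for every r ≥ r₀, the (unique) Gibbs measure μ of the n.n. Ising model on ℤ³ at (β_c(3), h =
0), and all f, g : {±1}^{ℤ³} → ℝ depending only on the spins in S_r = {r² ≤ |x|² < (r+1)²} resp.
S_{Lr}: Cov_μ(f,g)² ≤ θ·Var_μ(f)·Var_μ(g). Equivalently ρ_max(σ|S_r ; σ|S_{Lr})² ≤ θ < 1/L: "L-ades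
forget more than the free field's 1/L". [difficulty: open-problem] (why it might fail: it is η>0 in
disguise (open; all rigorous tools allow G≍‖x‖⁻¹); ρ_max sees every NONLINEAR sphere statistic, so
an unforeseen slow observable or O(1) prefactors (margin only L^0.036) could force θ·L ≥ 1 at all
practical L; even uniform forgetting θ<1 is unproved on ℤ³.) [doi:10.1137/0128010,
doi:10.1214/aop/1176995937, PolyanskiyWu2017, EvansEtAl2000, doi:10.1137/1105018,
doi:10.1007/BF01608988, arXiv:2210.13482, DuminilcopinPanis2025, PolandRychkovVichi2019]
#3 GaussianLimitIsFree (crux) — verbatim item GaussianLimitIsFree (stmt-CriticalPhenomena-2601) of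
route AnomalousForcesInteraction (shared): every non-degenerate, translation-invariant,
scale-covariant (dimension Δ) pointwise scaling limit S of criticalCorr 3 with U₄ ≡ 0 has Δ = 1/2
(Newman's Lee–Yang Gaussian criterion + Markov inheritance + Pitt–Kotani–Rozanov rigidity of Markov
Gaussian fields). [difficulty: XL] (why it might fail: conditional independence is not weakly
closed: O(δ)-shell information could survive in a Gaussian limit (hidden boundary memory), giving a
non-Markov generalized free field with Δ≠1/2 though every lattice measure is Markov; Kotani's
(1.3)–(1.4) need re-checking for generalized fields.) [Kotani1973, Pitt1971, Rozanov1982,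
Dobrushin1979, Newman1975, Panis2023Triviality]
#4 MoebiusLimit (crux) — verbatim item MoebiusLimit (stmt-CriticalPhenomena-1344, shared with
AnomalousForcesInteraction / PerfectScreening / IsingEuclidUpgrade): the critical correlators on ℤ³
have a non-degenerate pointwise scaling limit (ρ > 0 on (0,1], Δ > 0, S) that is Möbius covariant
with dimension Δ — the conjunct minus clause (iii); not attacked here (covariance routes own it).
[difficulty: open-problem] (why it might fail: existence of the pointwise limit, rotation invariance
and inversion covariance are each open on ℤ³ (ICM2022 §8.1, §8.4); ScaleCovarianceNotMoebius shows
Euclidean+scale data alone never force inversion (a dimension-2 virial current would break it).)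
[DuminilCopinICM2022, PolandRychkovVichi2019,
Literature.Barriers.CriticalPhenomena.ScaleCovarianceNotMoebius,
Literature.Probability.LatticeModels.CritIsing3DEuclideanLimit]
#9 ForgettingComposes (support) — (card (L1) in L² form; Witsenhausen's product rule on the shell
chain) for μ ∈ 𝒢(β_c(3)), L ≥ 2, r₀ ≥ 1, θ ≥ 0: if every pair (S_r, S_{Lr}), r ≥ r₀, satisfies Cov²
≤ θ·Var·Var for sphere-measurable f, g, then for every k and every g depending on the spins of
S_{L^k r₀}: Cov_μ(σ₀, g)² ≤ θ^k·Var_μ(σ₀)·Var_μ(g). Proof: induction on k; DLR for the finite ball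
{|x| < L^k r₀} (exterior boundary ⊂ S_{L^k r₀}) gives E[σ₀ | F_{ballᶜ}] = h(σ|S_{L^k r₀}); Cov(σ₀,g)
= Cov(h,g) ≤ √(θ Var h Var g) and Var h = Cov(σ₀,h) ≤ √(θ^k Var σ₀ Var h); base k = 0 is
Cauchy–Schwarz. Inputs in tree: isSpecification_isingSpecification_zd_holds, GibbsStrongMarkov
(integral_strongMarkov), condExp. [difficulty: M] [doi:10.1137/0128010, PolyanskiyWu2017,
Georgii2011, Literature.Probability.LatticeModels.isSpecification_isingSpecification_zd_holds]
#9 SphereCovarianceLowerBound (support) — (card (L2), covariance half) there are c > 0 and R₀ with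
Cov_μ(σ₀, Σ_{y∈S_R} σ_y) ≥ c·R²·⟨σ₀σ_{3R e₁}⟩_{β_c(3)} for all R ≥ R₀ and μ ∈ 𝒢(β_c(3)) (a
singleton: hasUniqueGibbsMeasure_criticalBeta_holds; μ = μ⁺ with spinCorr = plusCorr by
exists_plusMeasure_holds, ⟨σ_x⟩ = 0 by spontaneousMagnetization_criticalBeta_eq_zero_holds). Proof:
⟨σ₀σ_y⟩ ≥ ⟨σ₀σ_{3Re₁}⟩ for y ∈ S_R since 3‖y‖_∞ ≤ 3R (Messager–Miracle-Solé,
twoPointFree_le_of_mul_supNorm_le + twoPointPlus_criticalBeta_eq_twoPointFree_holds), and |S_R| ≥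
cR² (for a² + b² ≤ R² some c ≥ 0 has a²+b²+c² ∈ [R²,(R+1)²) because consecutive squares below R²
differ by ≤ 2R+1). [difficulty: M] [MessagerMiracleSoleJSP1977, DuminilCopin2019,
Literature.Probability.LatticeModels.twoPointFree_le_of_mul_supNorm_le,
Literature.Probability.LatticeModels.exists_plusMeasure_holds,
Literature.Probability.LatticeModels.hasUniqueGibbsMeasure_criticalBeta_holds]
#9 SphereVarianceUpperBound (support) — (card (L2), variance half: the infrared calibration) there
is C with Var_μ(Σ_{y∈S_R} σ_y) ≤ C·R³ for all R ≥ 1, μ ∈ 𝒢(β_c(3)). Proof: Var = Σ_{y,y′∈S_R}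
⟨σ_yσ_{y′}⟩ (zero magnetisation, translation invariance of μ⁺) ≤ Σ_y [1 + Σ_{y′≠y} C₀/‖y−y′‖_∞] by
the POINTWISE x-space infrared bound criticalTwoPoint_bounds_holds (d = 3: G ≤ C₀‖x‖⁻¹), and the
thin-shell counts #(S_R ∩ (y + [−k,k]³)) ≤ 5(2k+1)² for k ≤ R/4 (choose the coordinate axis closest
to radial: the third coordinate is pinned to ≤ 5 values), |S_R| ≤ C₁R², Abel summation Σ_k M_k/k² ≤
C₂R. This is the free-field order R² points × Σ_{k≤R} k·k⁻¹. [difficulty: M]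
[FrohlichSimonSpencer1976, AizenmanDuminilCopinSidoraviciusCMP2015,
Literature.Probability.LatticeModels.criticalTwoPoint_bounds_holds,
Literature.Probability.LatticeModels.exists_plusMeasure_holds]
#9 EtaFromForgetting (support) — (glue, the card's two-line CONSEQUENCE) SphereForgetting →
ForgettingComposes → SphereCovarianceLowerBound → SphereVarianceUpperBound → Target. Proof: take L,
θ, r₀ (enlarge r₀ ≥ R₀); with g = Σ_{S_R}σ_y at R = L^k r₀: c²R⁴G(3Re₁)² ≤ Cov² ≤ θ^k·Var σ₀·Var g ≤
θ^k·1·C R³, so G(3L^k r₀ e₁)² ≤ (C/c²)·θ^k/(L^k r₀); θ = 0 is trivial, else κ := log(1/θ)/log L > 1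
and G(3L^k r₀ e₁) ≤ C′(L^k)^{-(1+κ)/2}; for ‖x‖_∞ ≥ 9r₀ pick k maximal with 9L^k r₀ ≤ ‖x‖_∞, then
G(x) ≤ G(3L^k r₀ e₁) (MMS: 3‖3L^k r₀e₁‖_∞ ≤ ‖x‖_∞) ≤ C″‖x‖_∞^{-(1+κ)/2}; small x by G ≤ 1; the Pi
sup norm on Fin 3 → ℤ is ‖x‖_∞. Output exponent 1 + (κ−1)/2. [difficulty: M]
[MessagerMiracleSoleJSP1977, Literature.Probability.LatticeModels.twoPointFree_le_of_mul_supNorm_le,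
Literature.Probability.LatticeModels.twoPointPlus_criticalBeta_eq_twoPointFree_holds, EvansEtAl2000]
#9 DeltaLowerBound (support) — verbatim item DeltaLowerBound (stmt-CriticalPhenomena-2602) of route
AnomalousForcesInteraction (shared, provable now by adapting CriticalScalingDimension.lean): a
lattice bound ⟨σ₀σ_x⟩_{β_c(3)} ≤ C‖x‖^{-a} forces a ≤ 2Δ for every non-degenerate scale-covariant
(dimension Δ) pointwise scaling limit with ρ > 0. [difficulty: provable-now]
[Literature.Probability.LatticeModels.scalingDimension_mem_Icc_of_bounds,
Literature.Probability.LatticeModels.criticalTwoPoint_bounds_holds, Simon1980]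

TWO-LAYER PLAN. Foreseen split of the crux once something closes (k = 2, depth 1): SphereForgetting
⇐ LinearModeDominance → TwoPointSpectralForgetting
→ SphereForgetting, where TwoPointSpectralForgetting is the purely two-point statement "the
generalised top canonical correlation² of
the cross-Gram matrix (G(x−y))_{x∈S_r, y∈S_{Lr}} relative to the Gram matrices (G(x−x′))_{S_r},
(G(y−y′))_{S_{Lr}} is ≤ θ with
θ·L < 1 for r ≥ r₀" (linear statistics Σ a_xσ_x only — the Gaussian/GFF computation verbatim, corr²
= r/R at the free point) and
LinearModeDominance is the structural half "at large scale the top singular pair of the annulus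
conditional-expectation operator
lies in the odd one-spin sector up to a factor 1 + o(1)" (the radial-quantisation picture: the
lightest state is σ). Alternative child
if entropy tools bite (the card's spine (C)): KLOctaveContraction "η_KL(S_r → S_{Lr}) ≤ θ, θL < 1",
which implies SphereForgetting by
η_KL ≥ ρ_max² (Ahlswede–Gács) and is the natural target of Polchinski-flow / log-Sobolev multiscale
entropy bounds (arXiv:2202.02301)
and of non-linear SDPIs (arXiv:2005.05444). The three sphere lemmas and EtaFromForgetting are not
split (single estimates);
GaussianLimitIsFree / MoebiusLimit are decomposed by their home routes (MarkovRigidity →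
MarkovInheritance; covariance routes).

KILL CRITERIA. SphereForgetting is refuted by any proof that the infrared bound is saturated along a
geometric sequence of scales — G(3L^k r₀ e₁) ≥
c/(L^k r₀) for all k, for every L, r₀ — since the three (provable) sphere lemmas then force θ^k ≥
c′(L^k r₀)^{-1}, i.e. θL ≥ 1; such a
theorem (η(3) = 0 in power form) closes the route `refuted:SphereForgetting` and kills the card's
entropy form (C) with it ((C) ⇒
(C′)). A rigorous slow NONLINEAR sphere observable (ρ_max(S_r;S_{Lr})² ≥ c/L for all L) refutes
SphereForgetting but NOT η > 0: pivot
to the linear child TwoPointSpectralForgetting as the crux (route edit --restate).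
GaussianLimitIsFree refuted (a Markov
specification with Gaussian scale-covariant limit and Δ ≠ 1/2) ⇒ pivot X_AFI to PerfectScreening's
GaussianLimitIsCoulomb (item 1343:
Target contradicts c/‖x‖ ≤ G by arithmetic) or to any other consumer of EtaPositive. MoebiusLimit
refuted ⇒ the conjunct itself is
false (every route dies). EtaPositive (2600) proved elsewhere supersedes this route for the summit
(the sphere lemmas keep value as a
lattice SDPI calculus); item 0636 / NonGaussianAnyLimit proved elsewhere moots the whole η-line for
clause (iii).

NOT DECOMPOSED YET. The lattice-point counting on thin Euclidean shells (|S_R| ≍ R², cap counts ≤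
5(2k+1)²) and the identification μ = μ⁺, ⟨σ_yσ_{y′}⟩_μ
= criticalTwoPoint 3 (y′−y) inside the two sphere lemmas (layer-2 helper lemmas, `--supports`); the
DLR → conditional-expectation
bookkeeping inside ForgettingComposes; the real-analysis bookkeeping (θ^k ↔ R^{-κ}, rpow) inside
EtaFromForgetting; the entropy
version (C) with the card's Donsker–Varadhan/GHS lemma (L2) and its definition requests
(klContraction, sphereChannel) — not needed
in the L² form; the alternative separating family (cube boundaries ∂Λ_R make every lemma easier but
lose the exact free-field
calibration θ_GFF·L = 1, which holds for round spheres by Newton's theorem); any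
reflection-positivity / transfer-operator attack on
the annulus operator; the numerics of θ*(2).

CHEAPEST FALSIFIER. (a) On paper, consistency at the free points (a refuter can do this first): for
the massless lattice GFF on ℤ³ all three sphere
lemmas hold and the top canonical correlation² over ratio L is (cap S_r)/(cap S_{Lr}) → 1/L, so
SphereForgetting FAILS exactly at the
threshold (η = 0) — the criterion is sharp, not lossy; for n.n. Ising in d ≥ 5 (η = 0, lace
expansion) the d-dimensional analogue
θ·L^{d−2} < 1 must fail likewise, confirming that all d = 3 content sits in the crux. (b) Monte
Carlo (kit job for a refuter;
not run here, the hub is compute-free): Wolff-cluster critical Ising on Λ_256, canonical-correlation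
analysis (linear CCA on the
spins of S_r and S_{2r}, r = 8…48, then kernel CCA to probe nonlinear modes) against the discrete
GFF through the same pipeline:
prediction top corr² → 2^{-2Δσ} = 0.4877 (Ising) vs 0.500 (GFF); report θ̂(L)·L for L = 2, 3, 4 —
values ≥ 1 that do not decrease
with L, or kernel-CCA values well above linear CCA, retire the octave form and flag a slow nonlinear
mode. (c) Lookup (done, none
found): a polynomial ρ-mixing theorem across annuli for any 3-D critical lattice model would make
the qualitative half known.

NUMBERS. Δσ = 0.5181489(10), η = 2Δσ − 1 = 0.0362978(20) (conformal bootstrap,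
PolandRychkovVichi2019 Table II; the fuzzy-sphere
state-operator spectrum arXiv:2210.13482 reproduces Δσ ≈ 0.52 from energy levels on S²). Conjectured
per-scale constant θ*(L) =
L^{-2Δσ}: θ*(2) = 0.4877 so θ*(2)·2 = 0.975 (margin 2.5 %), θ*(8)·8 = 0.927, θ*(10³)·10³ = 0.778
(margin grows like L^{0.036}).
Free-field calibration: canonical corr² of the degree-ℓ harmonic modes between S_r and S_R is
(r/R)^{2ℓ+1}, top = r/R (ℓ = 0,
Newton's shell theorem); for general nested dilates K ⊂ LK the equilibrium-measure statistic gives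
corr² = cap(K)/cap(LK) = 1/L
exactly. Uniform-average test statistic at L = 2 with the Ising exponent 2Δ = 1.0363 (continuum
spheres): corr² =
((3^{0.9637} − 1)²)/8^{0.9637} = 0.478 < 0.4877 < 0.5. Rigorous window: c‖x‖⁻² ≤ ⟨σ₀σ_x⟩_{β_c(3)} ≤
C‖x‖⁻¹
(criticalTwoPoint_bounds_holds), Δ ∈ [1/2, 1] for any scale-covariant non-degenerate limit
(scalingDimension_mem_Icc_holds), η ≤ 1/2
if it exists (DuminilcopinPanis2025). In d dimensions the lemmas give Corr² ≥ cR^{d−2}G², the GFF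
has θ = L^{-(d−2)}, and the
criterion is θ·L^{d−2} < 1. Items at open: 10 (1 target, 3 cruxes of which 1 new, 5 support, 1
assembly).

DEFINITION REQUESTS. None for the filed items: covariances and variances are inline integrals
against μ ∈ isingGibbsMeasures 3 (criticalBeta 3) 0, the
shells are inline set-builders / Finset filters of Literature.Probability.LatticeModels.box, so
every statement elaborates today
(Sketch.lean rc 0). The card's requests (sphereChannel, klContraction, maxCorrelation,
latticeMutualInformation) are deferred to
the entropy child KLOctaveContraction and to the companion card mutual-information-modulus-law. No
cite facts wanted: every lattice
input of the support items is a proved theorem of the tree.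

Novelty: Searches (2026-08-15): `lit search --source local "maximal correlation Markov chain product
hypercontractivity Witsenhausen"` (1:
Raginsky arXiv:1411.3575, held); `lit search --source zbmath` × 10: "maximal correlation" (6, none
on random fields), "Kolmogorov
Rozanov strong mixing Gaussian" (2: doi:10.1137/1105018), "Witsenhausen dependent random variables"
(doi:10.1137/0128010), "Dembo
Kagan Shepp maximal correlation" (→ ChangChen2026 doi:10.1214/25-aap2293 = arXiv:2411.17109, read
pp. 1–3: exact ρ_max of random
walks / Lévy processes via Csáki–Fischer; Dadoun–Youssef 2021), "broadcasting on trees Ising"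
(doi:10.1214/aoap/1019487349 EKPS;
Gu–Polyanskiy arXiv:2005.05444 non-linear LSI and reconstruction), "maximal correlation random field
mixing" (Bradley 1986 ρ-mixing,
1-D), "mixing property random current Ising four dimensions" (0), "radial quantization lattice Ising
three dimensions" (0);
`lit galaxy search --star all` × 9 phrases ("maximal correlation coefficient", "strong data
processing", "mixing conditions for
random fields", "rho-mixing random fields", …: statistics / information-theory hits only) and one
`--mode intelligent --star pdf`
query on sphere-to-sphere canonical correlations (8: arXiv:1802.02319
Meneses–Penedones–Rychkov–Viana Parente Lopes–Yvernay
structural test of 3-D conformal invariance; Deng–Blöte 2003; CFT texts — nothing on correlations of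
sphere σ-algebras); `lit frontier
CriticalPhenomena --since 2021` (30 rows; nothing on η > 0 or cross-scale mixi  [refs: 10.1137/1105018, 10.1137/0128010, 10.1214/25-aap2293, 10.1214/aoap/1019487349, 10.1214/aop/1176995937, 10.1007/BF01608988, 1411.3575, 2411.17109, 2005.05444, 1802.02319, 2604.05772, 2210.13482, doi:10.1137/1105018, doi:10.1137/0128010, doi:10.1214/25-aap2293, doi:10.1214/aoap/1019487349, doi:10.1214/aop/1176995937, doi:10.1007/BF01608988, PolyanskiyWu2017, EvansEtAl2000]

Barriers (technique_class: sdpi-across-scales, maximal-correlation, markov-chain): - technique_class: sdpi-across-scales, maximal-correlation, markov-chain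
- Literature.Barriers.CriticalPhenomena.IsingTrivialityFromDimensionFour: evaded by location —
ForgettingComposes, the two sphere lemmas and EtaFromForgetting are dimension-uniform (on ℤ^d they
give Corr² ≥ cR^{d−2}G² and the criterion θ·L^{d−2} < 1), and the d-dimensional analogue of
SphereForgetting is FALSE for d ≥ 5 (η = 0; the free value θ = L^{-(d−2)} is attained), so nothing
dimension-uniform is claimed: all d = 3 content sits in the single crux, exactly where the barrier
says it must.
- Literature.Barriers.CriticalPhenomena.LongRangeTrivialityOnZ3: evaded — the shell Markov chain is
EXACT only for finite range; for the reflection-positive long-range models on ℤ³ with Gaussian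
limits (Δ = (3−α)/2) no shell separates and ForgettingComposes fails, so the argument is not
interaction-uniform (InteractionUniformZ3 breaks at the Markov step); the crux is stated for the
n.n. specification isingGibbsMeasures 3 only.
- Literature.Barriers.CriticalPhenomena.LaceExpansionIsingAboveFour: not engaged — no expansion, no
small parameter; the bet is a non-perturbative per-scale spectral inequality in d = 3 where the
bubble diverges.
- Literature.Barriers.CriticalPhenomena.RigorousRGSmallParameter: it does not supply one; the bet is
that a DIMENSIONLESS one-scale quantity (ρ_max over one L-ade) can be bounded without controlling an
RG flow — the composition law replaces the flow.
- Literature.Barriers.CriticalPhen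

Novelty grade: new-combination — ROUTE REVIEW (refuter rreview d2aef6b8, 2026-08-15): KEEP OPEN, no objection. Cruxes precise, typed without junk (finite spins ⇒ no integrability issues; box ⊇ shells; r₀ ≥ 1 keeps S_r ∩ S_{Lr} = ∅). SphereForgetting (8103) is the single honest open crux = ρ-mixing over one L-ade below the GFF const (refuter refuter-rreview-route-CriticalPhenomena--d2aef6b8-0, 2026-08-15T13:45:16Z; prior: doi:10.1137/0128010, doi:10.1214/aoap/1019487349, doi:10.1214/aop/1176995937, arXiv:1411.3575, FrohlichSimonSpencer1976, MessagerMiracleSoleJSP1977)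

History (route lifecycle, newest last):
- 2026-08-16T03:08:11Z · rev 4: restated EtaFromForgetting (stmt-CriticalPhenomena-8107) — route-choice (a), hold target-unreachable on Target: the glue Crux… → Target is now stated BY NAME — EtaFromForgetting restated 1:1 as SphereForgetting → Forget (planner-rchoice-CriticalPhenomena-OctaveForget-1cf72020-0)
- 2026-08-16T03:24:29Z · rev 4: restated EtaFromForgetting (stmt-CriticalPhenomena-14211) — route-repair (badge) part 2 — UNBREAK THE RENDER after a two-seat race on the same lint (rchoice-…-1cf72020 rev 4/6, rbadge-…-e6797b23 rev 5): the gate orders i (planner-rbadge-CriticalPhenomena-OctaveForgett-e6797b23-0)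
- 2026-08-16T03:24:29Z · rev 4: dropped ForgettingGivesTarget — route-repair (badge) part 2 — UNBREAK THE RENDER after a two-seat race on the same lint (rchoice-…-1cf72020 rev 4/6, rbadge-…-e6797b23 rev 5): the gate orders i (planner-rbadge-CriticalPhenomena-OctaveForgett-e6797b23-0)
- 2026-08-16T03:56:25Z · rev 4: restated Assembly (stmt-CriticalPhenomena-8108) — route-choice (a) part 3 — UNBREAK THE RENDER after the two-seat race (rchoice 1cf72020 revs 4/6, rbadge e6797b23 revs 5/7): the by-name glue now lives in EtaFro (planner-rchoice-CriticalPhenomena-OctaveForget-1cf72020-0)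
- 2026-08-25T04:52:32Z · DORMANT — reconciler: no traction for 7.4 d (last activity item-evidence-added at 2026-08-17T19:01:55Z); parked, not closed — `ledger route dormant route-CriticalPhenomen (operator:999:4025553)
- 2026-08-27T15:29:48Z · REACTIVATED — reconciler: reactivated — activity statement-checked at 2026-08-27T13:50:36Z after parking at 2026-08-25T04:52:32Z (operator:999:2171961)

sub-problem: Ising3DConformalLimit · status: open · opened planner-plancard-CriticalPhenomena-Ising3DCon-795e099f-0 2026-08-15T12:27:35Z · rev 6 · ledger route-CriticalPhenomena-OctaveForgetting
GENERATED by the gate from the ledger (D-0016/17). Provers cite these decls: `theorem foo : Summit.CriticalPhenomena.Ising3DConformalLimit.Theses.OctaveForgetting.<Decl> := …` in Summits/CriticalPhenomena/Ising3DConformalLimit/Theorems/<Name>.lean.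
-/

namespace Summit.CriticalPhenomena.Ising3DConformalLimit.Theses.OctaveForgetting

open scoped BigOperators Topology Manifold Classical MeasureTheory ProbabilityTheory Matrix InnerProductSpace ComplexConjugate ContinuousMap
open Filter Set Function TopologicalSpace MeasureTheory

attribute [summit_statement] _root_.Ising3DConformalLimit

/-- item stmt-CriticalPhenomena-2600 · crux (kind.auto-crux: conjecture-grade) · rank 0 · open · by planner
why it might fail: η(3)>0 is open: the rigorous window is c‖x‖⁻²≤G≤C‖x‖⁻¹ and η≤1/2 if it exists (DCP25 Thm 1.5); η≈0.036 is tiny, every rigorous tool is consistent with saturation G≍‖x‖⁻¹, and a proof of G≥c‖x‖⁻¹ along a sequence refutes it; here it inherits SphereForgetting.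
sources: DuminilcopinPanis2025, DuminilCopinICM2022, AizenmanDuminilCopinAnnals2021, PolandRychkovVichi2019, Literature.Probability.LatticeModels.criticalTwoPoint_bounds_holds, Literature.Probability.LatticeModels.dcp_isingEta_le_half
[crux] (AP) of the card: there are κ > 0 and C with ⟨σ₀σ_x⟩⁺_{β_c(3)} ≤ C‖x‖^{-(1+κ)} for all x ≠ 0
in ℤ³ (sup norm; η > 0 in the upper-bound form of HasIsingEtaBounds). Strictly improves the infrared
bound G ≤ C‖x‖^{-1} of criticalTwoPoint_bounds_holds at β_c(3). [difficulty: open-problem] -/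
@[route_item "route-CriticalPhenomena-OctaveForgetting", crux]
def Target : Prop :=
  ∃ κ C : ℝ, 0 < κ ∧ ∀ x : Literature.Probability.LatticeModels.Site 3, x ≠ 0 → Literature.Probability.LatticeModels.criticalTwoPoint 3 x ≤ C * (‖x‖ : ℝ) ^ (-(1 + κ))

/-- item stmt-CriticalPhenomena-8103 · crux · rank 2 · open · by planner
why it might fail: Strictly stronger than η(3)>0 (open: rigorous window c‖x‖⁻²≤G≤C‖x‖⁻¹, η≤1/2 by DCP25) with margin only L^{-0.036}; ρ_max counts every NONLINEAR shell statistic, so one slow observable or an O(1) prefactor forces θ·L≥1; even uniform θ<1 (ρ-mixing across one L-ade) is unproved at β_c(3).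
sources: doi:10.1137/0128010, doi:10.1214/aop/1176995937, PolyanskiyWu2017, EvansEtAl2000, doi:10.1137/1105018, doi:10.1007/BF01608988
[crux] (card (C′), free ratio) there are L ≥ 2, θ ∈ [0, 1/L) and r₀ ≥ 1 such that for every r ≥ r₀,
the (unique) Gibbs measure μ of the n.n. Ising model on ℤ³ at (β_c(3), h = 0), and all f, g :
{±1}^{ℤ³} → ℝ depending only on the spins in S_r = {r² ≤ |x|² < (r+1)²} resp. S_{Lr}: Cov_μ(f,g)² ≤
θ·Var_μ(f)·Var_μ(g). Equivalently ρ_max(σ|S_r ; σ|S_{Lr})² ≤ θ < 1/L: "L-ades forget more than the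
free field's 1/L". [difficulty: open-problem] -/
@[route_item "route-CriticalPhenomena-OctaveForgetting", crux]
def SphereForgetting : Prop :=
  ∃ L : ℕ, 2 ≤ L ∧ ∃ θ : ℝ, 0 ≤ θ ∧ θ * L < 1 ∧ ∃ r₀ : ℕ, 1 ≤ r₀ ∧ ∀ r : ℕ, r₀ ≤ r → ∀ μ ∈ Literature.Probability.LatticeModels.isingGibbsMeasures 3 (Literature.Probability.LatticeModels.criticalBeta 3) 0, ∀ f g : Literature.Probability.LatticeModels.SpinConfig (Literature.Probability.LatticeModels.Site 3) → ℝ, DependsOn f {x : Literature.Probability.LatticeModels.Site 3 | (r : ℤ) ^ 2 ≤ ∑ i, x i ^ 2 ∧ ∑ i, x i ^ 2 < ((r : ℤ) + 1) ^ 2} → DependsOn g {x : Literature.Probability.LatticeModels.Site 3 | ((L * r : ℕ) : ℤ) ^ 2 ≤ ∑ i, x i ^ 2 ∧ ∑ i, x i ^ 2 < (((L * r : ℕ) : ℤ) + 1) ^ 2} → (∫ σ, f σ * g σ ∂μ - (∫ σ, f σ ∂μ) * (∫ σ, g σ ∂μ)) ^ 2 ≤ θ * (∫ σ, f σ ^ 2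 ∂μ - (∫ σ, f σ ∂μ) ^ 2) * (∫ σ, g σ ^ 2 ∂μ - (∫ σ, g σ ∂μ) ^ 2)

/-- item stmt-CriticalPhenomena-2601 · crux · rank 3 · open · by planner
why it might fail: False iff the n.n. critical limit is a generalized free field with Δ∈(1/2,1] (OS-admissible; RP long-range models on ℤ³ have such limits, Panis23 Thm 1.2), so the claim is interaction-specific; the germ-Markov inheritance step is unprecedented: conditional independence is not weakly closed.
sources: Kotani1973, Pitt1971, Rozanov1982, Dobrushin1979, Newman1975, Panis2023Triviality
[crux] (MR)+(MI)+Newman of the card, fused into one typeable statement: for every renormalisation ρ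
> 0 on (0,1], Δ and S, if S is a pointwise scaling limit of criticalCorr 3 with non-degenerate
two-point function, translation invariant and scale covariant with dimension Δ, and U₄(S) ≡ 0 on
non-coincident configurations, then Δ = 1/2. Route of proof: U₄ ≡ 0 ⇒ smeared limit field Gaussian
(Newman 1975, Lee–Yang class; uniform integrability near diagonals from the all-scales limit + scale
covariance); n.n. Gibbs state Markov ⇒ limit germ-Markov (NEW: Markov inheritance); Pitt/Kotani Thm
2/Rozanov: spectral density 1/P, P entire of minimal exponential type, homogeneous of degree 3−2Δ ⇒
P quadratic form ⇒ Δ = 1/2 (Δ = 3/2 white noise excluded by non-degeneracy; window Δ∈[1/2,1] proved: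
scalingDimension_mem_Icc_holds). [difficulty: XL] -/
@[route_item "route-CriticalPhenomena-OctaveForgetting", crux]
def GaussianLimitIsFree : Prop :=
  ∀ (ρ : ℝ → ℝ) (Δ : ℝ) (S : Literature.Probability.LatticeModels.CorrFamily 3), (∀ δ ∈ Set.Ioc (0:ℝ) 1, 0 < ρ δ) → Literature.Probability.LatticeModels.HasPointwiseScalingLimit (Literature.Probability.LatticeModels.criticalCorr 3) ρ S → Literature.Probability.LatticeModels.IsNondegenerateTwoPoint S → Literature.Probability.LatticeModels.IsTranslationInvariant S → Literature.Probability.LatticeModels.IsScaleCovariant Δ S → ¬ Literature.Probability.LatticeModels.HasNontrivialU4 S → Δ = 1 / 2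

/-- item stmt-CriticalPhenomena-1344 · crux · rank 4 · open · by planner
why it might fail: existence of the pointwise limit, rotation invariance and inversion covariance are each open on ℤ³ (ICM2022 §8.1, §8.4); ScaleCovarianceNotMoebius shows Euclidean+scale data alone never force inversion (a dimension-2 virial current would break it).
sources: DuminilCopinICM2022, PolandRychkovVichi2019, Literature.Barriers.CriticalPhenomena.ScaleCovarianceNotMoebius, Literature.Probability.LatticeModels.CritIsing3DEuclideanLimit
[crux] r5 = MoebLim (IMPORTED COMPLEMENT, lowest rank): the critical Ising correlators on ℤ³ have a
non-degenerate pointwise scaling limit (ρ > 0 on (0,1], Δ > 0, S) that is Möbius covariant with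
dimension Δ — the conjunct Ising3DConformalLimit minus clause (iii). Written verbatim as the
conjunct's definiens without '∧ HasNontrivialU4 S' so that other routes filing the same complement
attach here. This route does not attack existence, rotation or inversion covariance; it bets on the
covariance lines (IsingEuclidUpgrade r5/r6 = items 0637/0638, IsingCFTData r2 = 0665, cards
hyperoctahedral-rp-rigidity / inversion-first-moebius-from-translations). S may be taken 0 off
NonCoincident, so no coincident-configuration junk obstructs the existential. -/
@[route_item "route-CriticalPhenomena-OctaveForgetting", crux]
def MoebiusLimit : Prop :=
  ∃ (ρ : ℝ → ℝ) (Δ : ℝ) (S : Literature.Probability.LatticeModels.CorrFamily 3), (∀ δ ∈ Set.Ioc (0:ℝ) 1, 0 < ρ δ) ∧ 0 < Δ ∧ Literature.Probability.LatticeModels.HasPointwiseScalingLimit (Literature.Probability.LatticeModels.criticalCorr 3) ρ S ∧ Literature.Probability.LatticeModels.IsNondegenerateTwoPoint S ∧ Literature.Probability.LatticeModels.IsMoebiusCovariant Δ S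

/-- item stmt-CriticalPhenomena-14438 · support · rank 9 · closed · proved by Summit.CriticalPhenomena.Ising3DConformalLimit.Theorems.EtaFromForgetting2_proof @ ef7c55cd1554 (prover) · by planner
sources: MessagerMiracleSoleJSP1977, Literature.Probability.LatticeModels.twoPointFree_le_of_mul_supNorm_le, Literature.Probability.LatticeModels.twoPointPlus_criticalBeta_eq_twoPointFree_holds, EvansEtAl2000
[support] (glue, the card's two-line CONSEQUENCE; concludes the Target BY NAME) SphereForgetting →
ForgettingComposes → SphereCovarianceLowerBound → SphereVarianceUpperBound → Target, rendered as
`SphereForgetting → (body of ForgettingComposes) → (body of SphereCovarianceLowerBound) → (body of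
SphereVarianceUpperBound) → Target` because the gate renders rank-9 items in string order of their
item ids, so this item (id 14211) is declared BEFORE
ForgettingComposes/SphereCovarianceLowerBound/SphereVarianceUpperBound (ids 8104–8106) and may only
name decls declared earlier (Target rank 0, SphereForgetting rank 2); the three bodies are verbatim
those items' statements, so the def is syntactically identical to the by-name chain after unfolding.
Proof: take L, θ, r₀ (enlarge r₀ ≥ R₀); with g = Σ_{S_R}σ_y at R = L^k r₀: c²R⁴G(3Re₁)² ≤ Cov² ≤
θ^k·Var σ₀·Var g ≤ θ^k·1·C R³, so G(3L^k r₀ e₁)² ≤ (C/c²)·θ^k/(L^k r₀); θ = 0 is trivial, else κ :=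
log(1/θ)/log L > 1 and G(3L^k r₀ e₁) ≤ C′(L^k)^{-(1+κ)/2}; for ‖x‖_∞ ≥ 9r₀ pick k maximal with 9L^k
r₀ ≤ ‖x‖_∞, then G(x) ≤ G(3L^k r₀ e₁) (MMS: 3‖3L^k r₀e₁‖_∞ ≤ ‖x‖_∞) ≤ C″‖x‖_∞^{-(1+κ)/2}; small x by
G ≤ 1; the Pi sup norm on Fin 3 → ℤ is ‖x‖_∞. Output e -/
@[route_item "route-CriticalPhenomena-OctaveForgetting"]
def EtaFromForgetting2 : Prop :=
  SphereForgetting → (∀ μ ∈ Literature.Probability.LatticeModels.isingGibbsMeasures 3 (Literature.Probability.LatticeModels.criticalBeta 3) 0, ∀ (L r₀ : ℕ) (θ : ℝ), 2 ≤ L → 1 ≤ r₀ → 0 ≤ θ → (∀ r : ℕ, r₀ ≤ r → ∀ f g : Literature.Probability.LatticeModels.SpinConfig (Literature.Probability.LatticeModels.Site 3) → ℝ, DependsOn f {x : Literature.Probability.LatticeModels.Site 3 | (r : ℤ) ^ 2 ≤ ∑ i, x i ^ 2 ∧ ∑ i, x i ^ 2 < ((r : ℤ) + 1) ^ 2} →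 DependsOn g {x : Literature.Probability.LatticeModels.Site 3 | ((L * r : ℕ) : ℤ) ^ 2 ≤ ∑ i, x i ^ 2 ∧ ∑ i, x i ^ 2 < (((L * r : ℕ) : ℤ) + 1) ^ 2} → (∫ σ, f σ * g σ ∂μ - (∫ σ, f σ ∂μ) * (∫ σ, g σ ∂μ)) ^ 2 ≤ θ * (∫ σ, f σ ^ 2 ∂μ - (∫ σ, f σ ∂μ) ^ 2) * (∫ σ, g σ ^ 2 ∂μ - (∫ σ, g σ ∂μ) ^ 2)) → ∀ (k : ℕ) (g : Literature.Probability.LatticeModels.SpinConfig (Literature.Probability.LatticeModels.Site 3) → ℝ), DependsOn g {x : Literature.Probability.LatticeModels.Site 3 | ((L ^ k * r₀ : ℕ) : ℤ) ^ 2 ≤ ∑ i, x i ^ 2 ∧ ∑ i, x i ^ 2 < (((L ^ k * r₀ : ℕ) : ℤ) + 1) ^ 2} → (∫ σ, Literature.Probability.LatticeModels.spinAt 0 σ * g σ ∂μ - (∫ σ, Literature.Probability.LatticeModels.spinAt 0 σ ∂μ) * (∫ σ, g σ ∂μ)) ^ 2 ≤ θ ^ k * (∫ σ, Literature.Probability.LatticeModels.spinAt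 0 σ ^ 2 ∂μ - (∫ σ, Literature.Probability.LatticeModels.spinAt 0 σ ∂μ) ^ 2) * (∫ σ, g σ ^ 2 ∂μ - (∫ σ, g σ ∂μ) ^ 2)) → (∃ c : ℝ, 0 < c ∧ ∃ R₀ : ℕ, 1 ≤ R₀ ∧ ∀ R : ℕ, R₀ ≤ R → ∀ μ ∈ Literature.Probability.LatticeModels.isingGibbsMeasures 3 (Literature.Probability.LatticeModels.criticalBeta 3) 0, c * (R : ℝ) ^ 2 * Literature.Probability.LatticeModels.criticalTwoPoint 3 (Pi.single 0 (3 * (R : ℤ))) ≤ ∫ σ, Literature.Probability.LatticeModels.spinAt 0 σ * (∑ y ∈ (Literature.Probability.LatticeModels.box 3 R).filter (fun y => (R : ℤ) ^ 2 ≤ ∑ i, y i ^ 2 ∧ ∑ i, y i ^ 2 < ((R : ℤ) + 1) ^ 2), Literature.Probability.LatticeModels.spinAt y σ) ∂μ - (∫ σ, Literature.Probability.LatticeModels.spinAt 0 σ ∂μ) * (∫ σ, (∑ y ∈ (Literature.Probability.LatticeModels.box 3 R).filter (fun y => (R : ℤ) ^ 2 ≤ ∑ i, y i ^ 2 ∧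 ∑ i, y i ^ 2 < ((R : ℤ) + 1) ^ 2), Literature.Probability.LatticeModels.spinAt y σ) ∂μ)) → (∃ C : ℝ, ∀ R : ℕ, 1 ≤ R → ∀ μ ∈ Literature.Probability.LatticeModels.isingGibbsMeasures 3 (Literature.Probability.LatticeModels.criticalBeta 3) 0, ∫ σ, (∑ y ∈ (Literature.Probability.LatticeModels.box 3 R).filter (fun y => (R : ℤ) ^ 2 ≤ ∑ i, y i ^ 2 ∧ ∑ i, y i ^ 2 < ((R : ℤ) + 1) ^ 2), Literature.Probability.LatticeModels.spinAt y σ) ^ 2 ∂μ - (∫ σ, (∑ y ∈ (Literature.Probability.LatticeModels.box 3 R).filter (fun y => (R : ℤ) ^ 2 ≤ ∑ i, y i ^ 2 ∧ ∑ i, y i ^ 2 < ((R : ℤ) + 1) ^ 2), Literature.Probability.LatticeModels.spinAt y σ) ∂μ) ^ 2 ≤ C * (R : ℝ) ^ 3) → Target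

-- `EtaFromForgetting2` holds: proved by `Summit.CriticalPhenomena.Ising3DConformalLimit.Theorems.EtaFromForgetting2_proof` @ ef7c55cd1554 (its module imports this route file, so no `_holds` link can be stated here).

/-- item stmt-CriticalPhenomena-2602 · support · rank 9 · closed · proved by Summit.CriticalPhenomena.Ising3DConformalLimit.Theorems.DeltaLowerBound_proof @ 01bdd1a198f2 (prover) · by planner
sources: Literature.Probability.LatticeModels.scalingDimension_mem_Icc_of_bounds, Literature.Probability.LatticeModels.criticalTwoPoint_bounds_holds, Simon1980
[support] glue, provable now by adapting CriticalScalingDimension.lean (dyadic meshes δ_k =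
2^{-(k+1)}: log ρ(δ_k)²/k → 2Δ log 2 from scale covariance + convergence at (0,e),(0,2e); the
lattice bound at ‖2^{k+1}e₁‖ gives log ρ(δ_k)² ≥ a(k+1)log 2 − log C + O(1)): if ⟨σ₀σ_x⟩_{β_c(3)} ≤
C‖x‖^{-a} for all x ≠ 0 then every non-degenerate scale-covariant (dimension Δ) pointwise scaling
limit with ρ > 0 has a ≤ 2Δ. (C ≤ 0 is vacuous by the Simon–Lieb lower bound; a ≤ 1 is covered by
scalingDimension_mem_Icc_holds.) [difficulty: provable-now] -/
@[route_item "route-CriticalPhenomena-OctaveForgetting"]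
def DeltaLowerBound : Prop :=
  ∀ (a C : ℝ) (ρ : ℝ → ℝ) (Δ : ℝ) (S : Literature.Probability.LatticeModels.CorrFamily 3), (∀ x : Literature.Probability.LatticeModels.Site 3, x ≠ 0 → Literature.Probability.LatticeModels.criticalTwoPoint 3 x ≤ C * (‖x‖ : ℝ) ^ (-a)) → (∀ δ ∈ Set.Ioc (0:ℝ) 1, 0 < ρ δ) → Literature.Probability.LatticeModels.HasPointwiseScalingLimit (Literature.Probability.LatticeModels.criticalCorr 3) ρ S → Literature.Probability.LatticeModels.IsNondegenerateTwoPoint S → Literature.Probability.LatticeModels.IsScaleCovariant Δ S → a ≤ 2 * Δ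

/-- `DeltaLowerBound` holds: proved by `Summit.CriticalPhenomena.Ising3DConformalLimit.Theorems.DeltaLowerBound_proof` @ 01bdd1a198f2. -/
theorem DeltaLowerBound_holds : DeltaLowerBound := _root_.Summit.CriticalPhenomena.Ising3DConformalLimit.Theorems.DeltaLowerBound_proof

/-- item stmt-CriticalPhenomena-8104 · support · rank 9 · closed · proved by Summit.CriticalPhenomena.Ising3DConformalLimit.Theorems.forgettingComposes_proof @ e0e1770ad391 (prover) · by planner
sources: doi:10.1137/0128010, PolyanskiyWu2017, Georgii2011, Literature.Probability.LatticeModels.isSpecification_isingSpecification_zd_holds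
[support] (card (L1) in L² form; Witsenhausen's product rule on the shell chain) for μ ∈ 𝒢(β_c(3)),
L ≥ 2, r₀ ≥ 1, θ ≥ 0: if every pair (S_r, S_{Lr}), r ≥ r₀, satisfies Cov² ≤ θ·Var·Var for
sphere-measurable f, g, then for every k and every g depending on the spins of S_{L^k r₀}: Cov_μ(σ₀,
g)² ≤ θ^k·Var_μ(σ₀)·Var_μ(g). Proof: induction on k; DLR for the finite ball {|x| < L^k r₀}
(exterior boundary ⊂ S_{L^k r₀}) gives E[σ₀ | F_{ballᶜ}] = h(σ|S_{L^k r₀}); Cov(σ₀,g) = Cov(h,g) ≤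
√(θ Var h Var g) and Var h = Cov(σ₀,h) ≤ √(θ^k Var σ₀ Var h); base k = 0 is Cauchy–Schwarz. Inputs
in tree: isSpecification_isingSpecification_zd_holds, GibbsStrongMarkov (integral_strongMarkov),
condExp. [difficulty: M] -/
@[route_item "route-CriticalPhenomena-OctaveForgetting"]
def ForgettingComposes : Prop :=
  ∀ μ ∈ Literature.Probability.LatticeModels.isingGibbsMeasures 3 (Literature.Probability.LatticeModels.criticalBeta 3) 0, ∀ (L r₀ : ℕ) (θ : ℝ), 2 ≤ L → 1 ≤ r₀ → 0 ≤ θ → (∀ r : ℕ, r₀ ≤ r → ∀ f g : Literature.Probability.LatticeModels.SpinConfig (Literature.Probability.LatticeModels.Site 3) → ℝ, DependsOn f {x : Literature.Probability.LatticeModels.Site 3 | (r : ℤ) ^ 2 ≤ ∑ i, x i ^ 2 ∧ ∑ i, x i ^ 2 < ((r : ℤ) + 1) ^ 2} → DependsOn g {x : Literature.Probability.LatticeModels.Site 3 | ((L * r : ℕ) : ℤ) ^ 2 ≤ ∑ i, x i ^ 2 ∧ ∑ i, x i ^ 2 < (((L * r : ℕ) : ℤ) + 1) ^ 2} → (∫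 σ, f σ * g σ ∂μ - (∫ σ, f σ ∂μ) * (∫ σ, g σ ∂μ)) ^ 2 ≤ θ * (∫ σ, f σ ^ 2 ∂μ - (∫ σ, f σ ∂μ) ^ 2) * (∫ σ, g σ ^ 2 ∂μ - (∫ σ, g σ ∂μ) ^ 2)) → ∀ (k : ℕ) (g : Literature.Probability.LatticeModels.SpinConfig (Literature.Probability.LatticeModels.Site 3) → ℝ), DependsOn g {x : Literature.Probability.LatticeModels.Site 3 | ((L ^ k * r₀ : ℕ) : ℤ) ^ 2 ≤ ∑ i, x i ^ 2 ∧ ∑ i, x i ^ 2 < (((L ^ k * r₀ : ℕ) : ℤ) + 1) ^ 2} → (∫ σ, Literature.Probability.LatticeModels.spinAt 0 σ * g σ ∂μ - (∫ σ, Literature.Probability.LatticeModels.spinAt 0 σ ∂μ) * (∫ σ, g σ ∂μ)) ^ 2 ≤ θ ^ k * (∫ σ, Literature.Probability.LatticeModels.spinAt 0 σ ^ 2 ∂μ - (∫ σ, Literature.Probability.LatticeModels.spinAt 0 σ ∂μ) ^ 2) * (∫ σ, g σ ^ 2 ∂μ - (∫ σ, g σ ∂μ) ^ 2)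

-- `ForgettingComposes` holds: proved by `Summit.CriticalPhenomena.Ising3DConformalLimit.Theorems.forgettingComposes_proof` @ e0e1770ad391 (its module imports this route file, so no `_holds` link can be stated here).

/-- item stmt-CriticalPhenomena-8105 · support · rank 9 · closed · proved by Summit.CriticalPhenomena.Ising3DConformalLimit.Theorems.SphereCovarianceLowerBound_proof @ 8cfc01d3434a (prover) · by planner
sources: MessagerMiracleSoleJSP1977, DuminilCopin2019, Literature.Probability.LatticeModels.twoPointFree_le_of_mul_supNorm_le, Literature.Probability.LatticeModels.exists_plusMeasure_holds, Literature.Probability.LatticeModels.hasUniqueGibbsMeasure_criticalBeta_holds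
[support] (card (L2), covariance half) there are c > 0 and R₀ with Cov_μ(σ₀, Σ_{y∈S_R} σ_y) ≥
c·R²·⟨σ₀σ_{3R e₁}⟩_{β_c(3)} for all R ≥ R₀ and μ ∈ 𝒢(β_c(3)) (a singleton:
hasUniqueGibbsMeasure_criticalBeta_holds; μ = μ⁺ with spinCorr = plusCorr by
exists_plusMeasure_holds, ⟨σ_x⟩ = 0 by spontaneousMagnetization_criticalBeta_eq_zero_holds). Proof:
⟨σ₀σ_y⟩ ≥ ⟨σ₀σ_{3Re₁}⟩ for y ∈ S_R since 3‖y‖_∞ ≤ 3R (Messager–Miracle-Solé,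
twoPointFree_le_of_mul_supNorm_le + twoPointPlus_criticalBeta_eq_twoPointFree_holds), and |S_R| ≥
cR² (for a² + b² ≤ R² some c ≥ 0 has a²+b²+c² ∈ [R²,(R+1)²) because consecutive squares below R²
differ by ≤ 2R+1). [difficulty: M] -/
@[route_item "route-CriticalPhenomena-OctaveForgetting"]
def SphereCovarianceLowerBound : Prop :=
  ∃ c : ℝ, 0 < c ∧ ∃ R₀ : ℕ, 1 ≤ R₀ ∧ ∀ R : ℕ, R₀ ≤ R → ∀ μ ∈ Literature.Probability.LatticeModels.isingGibbsMeasures 3 (Literature.Probability.LatticeModels.criticalBeta 3) 0, c * (R : ℝ) ^ 2 * Literature.Probability.LatticeModels.criticalTwoPoint 3 (Pi.single 0 (3 * (R : ℤ))) ≤ ∫ σ, Literature.Probability.LatticeModels.spinAt 0 σ * (∑ y ∈ (Literature.Probability.LatticeModels.box 3 R).filter (fun y => (R : ℤ) ^ 2 ≤ ∑ i, y i ^ 2 ∧ ∑ i, y i ^ 2 < ((R : ℤ) + 1) ^ 2), Literature.Probability.LatticeModels.spinAt y σ) ∂μ - (∫ σ, Literature.Probability.LatticeModels.spinAt 0 σ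 ∂μ) * (∫ σ, (∑ y ∈ (Literature.Probability.LatticeModels.box 3 R).filter (fun y => (R : ℤ) ^ 2 ≤ ∑ i, y i ^ 2 ∧ ∑ i, y i ^ 2 < ((R : ℤ) + 1) ^ 2), Literature.Probability.LatticeModels.spinAt y σ) ∂μ)

-- `SphereCovarianceLowerBound` holds: proved by `Summit.CriticalPhenomena.Ising3DConformalLimit.Theorems.SphereCovarianceLowerBound_proof` @ 8cfc01d3434a (its module imports this route file, so no `_holds` link can be stated here).

/-- item stmt-CriticalPhenomena-8106 · support · rank 9 · closed · proved by Summit.CriticalPhenomena.Ising3DConformalLimit.Theorems.SphereVarianceUpperBound_proof @ c2357d5c8d93 (prover) · by planner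
sources: FrohlichSimonSpencer1976, AizenmanDuminilCopinSidoraviciusCMP2015, Literature.Probability.LatticeModels.criticalTwoPoint_bounds_holds, Literature.Probability.LatticeModels.exists_plusMeasure_holds
[support] (card (L2), variance half: the infrared calibration) there is C with Var_μ(Σ_{y∈S_R} σ_y)
≤ C·R³ for all R ≥ 1, μ ∈ 𝒢(β_c(3)). Proof: Var = Σ_{y,y′∈S_R} ⟨σ_yσ_{y′}⟩ (zero magnetisation,
translation invariance of μ⁺) ≤ Σ_y [1 + Σ_{y′≠y} C₀/‖y−y′‖_∞] by the POINTWISE x-space infrared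
bound criticalTwoPoint_bounds_holds (d = 3: G ≤ C₀‖x‖⁻¹), and the thin-shell counts #(S_R ∩ (y +
[−k,k]³)) ≤ 5(2k+1)² for k ≤ R/4 (choose the coordinate axis closest to radial: the third coordinate
is pinned to ≤ 5 values), |S_R| ≤ C₁R², Abel summation Σ_k M_k/k² ≤ C₂R. This is the free-field
order R² points × Σ_{k≤R} k·k⁻¹. [difficulty: M] -/
@[route_item "route-CriticalPhenomena-OctaveForgetting"]
def SphereVarianceUpperBound : Prop :=
  ∃ C : ℝ, ∀ R : ℕ, 1 ≤ R → ∀ μ ∈ Literature.Probability.LatticeModels.isingGibbsMeasures 3 (Literature.Probability.LatticeModels.criticalBeta 3) 0, ∫ σ, (∑ y ∈ (Literature.Probability.LatticeModels.box 3 R).filter (fun y => (R : ℤ) ^ 2 ≤ ∑ i, y i ^ 2 ∧ ∑ i, y i ^ 2 < ((R : ℤ) + 1) ^ 2), Literature.Probability.LatticeModels.spinAt y σ) ^ 2 ∂μ - (∫ σ, (∑ y ∈ (Literature.Probability.LatticeModels.box 3 R).filter (fun y => (R : ℤ) ^ 2 ≤ ∑ i, y i ^ 2 ∧ ∑ i,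 y i ^ 2 < ((R : ℤ) + 1) ^ 2), Literature.Probability.LatticeModels.spinAt y σ) ∂μ) ^ 2 ≤ C * (R : ℝ) ^ 3

-- `SphereVarianceUpperBound` holds: proved by `Summit.CriticalPhenomena.Ising3DConformalLimit.Theorems.SphereVarianceUpperBound_proof` @ c2357d5c8d93 (its module imports this route file, so no `_holds` link can be stated here).

-- earlier EtaFromForgetting (stmt-CriticalPhenomena-8107, replaced 2026-08-16T03:08:11Z -> stmt-CriticalPhenomena-14211): retired by None — (∃ L : ℕ, 2 ≤ L ∧ ∃ θ : ℝ, 0 ≤ θ ∧ θ * L < 1 ∧ ∃ r₀ : ℕ, 1 ≤ r₀ ∧ ∀ r : ℕ, r₀ ≤ r → ∀ μ ∈ Literature.Probability.LatticeModels.isingGibbsMeasures 3 (Literature.Probability.LatticeModels.criticalBeta 3) 0, ∀ f g : Literature.Probability.LatticeModels.SpinConfig (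
/-- item stmt-CriticalPhenomena-14211 · support · rank 9 · closed · None by None · by planner
sources: MessagerMiracleSoleJSP1977, Literature.Probability.LatticeModels.twoPointFree_le_of_mul_supNorm_le, Literature.Probability.LatticeModels.twoPointPlus_criticalBeta_eq_twoPointFree_holds, EvansEtAl2000
[support] (glue, the card's two-line CONSEQUENCE) SphereForgetting → ForgettingComposes →
SphereCovarianceLowerBound → SphereVarianceUpperBound → Target. Proof: take L, θ, r₀ (enlarge r₀ ≥
R₀); with g = Σ_{S_R}σ_y at R = L^k r₀: c²R⁴G(3Re₁)² ≤ Cov² ≤ θ^k·Var σ₀·Var g ≤ θ^k·1·C R³, so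
G(3L^k r₀ e₁)² ≤ (C/c²)·θ^k/(L^k r₀); θ = 0 is trivial, else κ := log(1/θ)/log L > 1 and G(3L^k r₀
e₁) ≤ C′(L^k)^{-(1+κ)/2}; for ‖x‖_∞ ≥ 9r₀ pick k maximal with 9L^k r₀ ≤ ‖x‖_∞, then G(x) ≤ G(3L^k r₀
e₁) (MMS: 3‖3L^k r₀e₁‖_∞ ≤ ‖x‖_∞) ≤ C″‖x‖_∞^{-(1+κ)/2}; small x by G ≤ 1; the Pi sup norm on Fin 3 →
ℤ is ‖x‖_∞. Output exponent 1 + (κ−1)/2. [difficulty: M] -/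
@[route_item "route-CriticalPhenomena-OctaveForgetting"]
def EtaFromForgetting : Prop :=
  SphereForgetting → ForgettingComposes → SphereCovarianceLowerBound → SphereVarianceUpperBound → Target

/-- item stmt-CriticalPhenomena-14216 · support · rank 9 · closed · None by None · by planner
sources: EvansEtAl2000, doi:10.1137/0128010
[support] glue (A11 target edge): the conversion lemma EtaFromForgetting applied to the crux
SphereForgetting and the sphere lemmas ForgettingComposes, SphereCovarianceLowerBound,
SphereVarianceUpperBound yields the Target (η(3) > 0 in power form: ∃ κ > 0, C, ⟨σ₀σ_x⟩_{β_c(3)} ≤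
C‖x‖^{-(1+κ)}) BY NAME. EtaFromForgetting is verbatim the unfolding of SphereForgetting →
ForgettingComposes → SphereCovarianceLowerBound → SphereVarianceUpperBound → Target, so the proof is
one line, `fun h hF hC hL hU => h hF hC hL hU` (planner Sketch.lean rc 0); filed so that an item of
the route concludes Target and the closure graph reads cruxes → Target → Statement; all the real
analysis stays in EtaFromForgetting. [deps: EtaFromForgetting, SphereForgetting, ForgettingComposes,
SphereCovarianceLowerBound, SphereVarianceUpperBound] [difficulty: provable-now] -/
@[route_item "route-CriticalPhenomena-OctaveForgetting"]
def ForgettingGivesTarget : Prop :=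
  EtaFromForgetting → SphereForgetting → ForgettingComposes → SphereCovarianceLowerBound → SphereVarianceUpperBound → Target

-- earlier Assembly (stmt-CriticalPhenomena-8108, replaced 2026-08-16T03:56:25Z -> stmt-CriticalPhenomena-14566): retired by None — SphereForgetting → ForgettingComposes → SphereCovarianceLowerBound → SphereVarianceUpperBound → EtaFromForgetting → GaussianLimitIsFree → DeltaLowerBound → MoebiusLimit → Ising3DConformalLimit
/-- item stmt-CriticalPhenomena-14566 · assembly · rank 1 · closed · proved by Summit.CriticalPhenomena.Ising3DConformalLimit.Theorems.octaveForgetting_assembly_proof @ 132c97a66e49 (prover) · by planner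
sources: EvansEtAl2000, Newman1975, Kotani1973, DuminilCopinICM2022
[assembly] SphereForgetting → ForgettingComposes → SphereCovarianceLowerBound →
SphereVarianceUpperBound → EtaFromForgetting → GaussianLimitIsFree → DeltaLowerBound → MoebiusLimit
→ Ising3DConformalLimit. -/
@[route_item "route-CriticalPhenomena-OctaveForgetting"]
def Assembly : Prop :=
  SphereForgetting → ForgettingComposes → SphereCovarianceLowerBound → SphereVarianceUpperBound → EtaFromForgetting2 → GaussianLimitIsFree → DeltaLowerBound → MoebiusLimit → Ising3DConformalLimit

-- `Assembly` holds: proved by `Summit.CriticalPhenomena.Ising3DConformalLimit.Theorems.octaveForgetting_assembly_proof` @ 132c97a66e49 (its module imports this route file, so no `_holds` link can be stated here).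

/-! D-0027 §2.1 — DECIDING THEOREM (planner-authored via `route open/edit --closes-file`; by planner-rbadge-CriticalPhenomena-OctaveForgett-e6797b23-g2-0 2026-08-16T05:48:16Z):
its hypotheses are this route's items and its conclusion the sub-problem Statement (glue_lint), and it elaborates with this file. -/

/-- D-0027 §2.1 deciding theorem of route `OctaveForgetting` (route-repair 2026-08-16, rev 6: CRUX-ONLY
hypotheses, answering `glue.non-crux-hypothesis`). From the route's crux-kind items `Target` (η(3) > 0 in
power form, auto-crux: the dividend this route exists to produce), `SphereForgetting` (the bet; carried so
that it stays wired to the Statement — its conversion into `Target` is the OPEN support chain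
ForgettingComposes / SphereCovarianceLowerBound / SphereVarianceUpperBound / EtaFromForgetting2, to be
proved by provers and never assumed here), `GaussianLimitIsFree` and `MoebiusLimit` to the sub-problem
Statement `_root_.Ising3DConformalLimit`. The support item `DeltaLowerBound` (stmt-CriticalPhenomena-2602 ·
closed · proved 2026-08-16T04:14Z by `Summit.CriticalPhenomena.Ising3DConformalLimit.Theorems.DeltaLowerBound_proof`
@ 2a72730ee326, the dyadic argument of `scalingDimension_mem_Icc_of_bounds` with `C‖x‖^{-a}` in place of
`C‖x‖⁻¹`) is no longer a hypothesis: it is USED inside the proof through the gate-written link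
`DeltaLowerBound_holds` rendered with the item above. Logic (unchanged from rev 5): `MoebiusLimit` gives
`(ρ, Δ, S)`; were `U₄ ≡ 0`, `GaussianLimitIsFree` (translation invariance and scale covariance read off
`IsMoebiusCovariant` as `hM.1.1`, `hM.2.1`) gives `Δ = 1/2`, while `Target` (`a := 1 + κ`, `κ > 0`) and
`DeltaLowerBound` give `1 + κ ≤ 2Δ = 1` — absurd; hence clause (iii) `U₄ ≢ 0` and the conjunct. Certified by
`ledger route check --native --id … --closes-file` (gate render, lean rc 0, `h21_check_closes` ok, non_crux [],
axioms propext / Classical.choice / Quot.sound); an 85-line variant discharging `DeltaLowerBound` by the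
inlined Literature proof (planner folder glue_inline.lean / Sketch.lean, rc 0) is kept as fallback. -/
@[closes "route-CriticalPhenomena-OctaveForgetting"] theorem closes : Target → SphereForgetting → GaussianLimitIsFree → MoebiusLimit → _root_.Ising3DConformalLimit := by
  intro h_Target _h_SphereForgetting h_GaussianLimitIsFree h_MoebiusLimit
  -- support item `DeltaLowerBound` (stmt-CriticalPhenomena-2602 · closed · proved), USED not assumed:
  -- the gate-written link `DeltaLowerBound_holds := Theorems.DeltaLowerBound_proof` rendered with the item.
  have h_DeltaLowerBound : DeltaLowerBound := DeltaLowerBound_holds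
  obtain ⟨κ, C, hκ, hb⟩ := h_Target
  obtain ⟨ρ, Δ, S, hρ, hΔ, hlim, hnd, hM⟩ := h_MoebiusLimit
  refine ⟨ρ, Δ, S, hρ, hΔ, hlim, hnd, hM, ?_⟩
  by_contra hU
  have h1 : Δ = 1 / 2 := h_GaussianLimitIsFree ρ Δ S hρ hlim hnd hM.1.1 hM.2.1 hU
  have h2 : 1 + κ ≤ 2 * Δ := h_DeltaLowerBound (1 + κ) C ρ Δ S hb hρ hlim hnd hM.2.1
  linarith

end Summit.CriticalPhenomena.Ising3DConformalLimit.Theses.OctaveForgetting
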